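import Literature.ModelTheory.ExponentialFields.PilaWilkieParametrizationLimits
import Literature.ModelTheory.ExponentialFields.OMinimalIntervals
import Mathlib.MeasureTheory.Measure.Lebesgue.Basic
import Mathlib.Topology.MetricSpace.Lipschitz
import HarnessLib

/-!
# The limit charts cover a cofinite set (Bhardwaj–van den Dries 2022, Lemma 6.1 (A))

Topic `Literature/ModelTheory/ExponentialFields`; proof file in the cone of the named fact
`PilaWilkie2006_thm_1_8`.  In Bhardwaj–van den Dries 2022, §6 a definable family of
`k`-parametrizations `Φ_s = {F_{s1}, …, F_{sN}}` of `(0,1)` (`0 < s < 1`) is replaced by its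
limit `Φ₀` as `s → 0⁺`; Lemma 6.1 (A) says that *"`⋃_{ψ ∈ Φ₀} image(ψ)` is a cofinite subset
of `(0,1)`"*.  This file proves it over `ℝ` (`finite_compl_iUnion_image_limitCharts`) exactly
as printed — a missed interval `[a, b]`, an index `j` good for all small `s` (o-minimality:
`exists_index_Ioo_subset`), a segment of definite length in `F_j(s,(0,1)) ∩ [a,b]`
(pigeonhole by Lebesgue measure: `exists_index_volume_ge`, `exists_Icc_subset_of_ordConnected`),
the Lipschitz argument placing a preimage in `[δ, 1−δ]`
(`exists_mem_Icc_preimage_of_lipschitz`), a definable selection `t_s` by infima, its limit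
`t₀`, and uniform convergence on `[δ, 1−δ]` — with "strongly bounded derivative" replaced by
`1`-Lipschitz and saturation by explicit o-minimal limits.

Nothing here is a named fact; no definitions.

## References

* N. Bhardwaj, L. van den Dries, *On the Pila–Wilkie theorem*, Expo. Math. 40 (2022), §6,
  Lemma 6.1 and its proof. [BhardwajVanDenDries2022]
-/

noncomputable section

open Set FirstOrder FirstOrder.Language Filter Topology Function MeasureTheory

namespace Literature.ModelTheory.ExponentialFields

/-! ### Ingredients of Bhardwaj–van den Dries 2022, Lemma 6.1 (A) -/

section CoverLemmas

variable {L : Language} [L.Structure ℝ]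

/-- **One index works on an initial segment**: if finitely many definable subsets of `ℝ` cover
`(0,1)` then one of them contains a whole interval `(0, ε)` (right germs at `0` of definable
sets are constant, o-minimality; Bhardwaj–van den Dries 2022, proof of Lemma 6.1: *"By
o-minimality we have a fixed `i` and an `ε ∈ (0,1)` such that for all `s < ε` …"*).
[cite: BhardwajVanDenDries2022, Lemma 6.1 (proof)] -/
theorem exists_index_Ioo_subset (hO : L.IsOMinimal ℝ) {J : Type} [Fintype J]
    (S : J → Set ℝ) (hS : ∀ j, (univ : Set ℝ).Definable₁ L (S j)) (hcov : Ioo (0 : ℝ) 1 ⊆ ⋃ j, S j) :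
    ∃ j ε, 0 < ε ∧ Ioo 0 ε ⊆ S j := by
  classical
  have hgerm : ∀ j, ∃ c, 0 < c ∧ (Ioo 0 c ⊆ S j ∨ Disjoint (Ioo 0 c) (S j)) := fun j =>
    (hO _ (hS j)).exists_Ioo_subset_or_disjoint_right 0
  choose c hc0 hc using hgerm
  by_contra hnone
  push Not at hnone
  -- all `S j` miss `(0, c j)`; take `ε = min (min_j c j) 1`
  have hdisj : ∀ j, Disjoint (Ioo 0 (c j)) (S j) := fun j => by
    rcases hc j with h | h
    · exact absurd h (hnone j (c j) (hc0 j))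
    · exact h
  have hne : (Finset.univ.image c).Nonempty ∨ IsEmpty J := by
    by_cases h : Nonempty J
    · obtain ⟨j⟩ := h; exact Or.inl ⟨c j, Finset.mem_image.mpr ⟨j, Finset.mem_univ _, rfl⟩⟩
    · exact Or.inr (not_nonempty_iff.mp h)
  rcases hne with hne | hJ
  · set ε : ℝ := min ((Finset.univ.image c).min' hne) 1 with hε
    have hεpos : 0 < ε := by
      refine lt_min ?_ one_pos
      obtain ⟨j, -, hj⟩ := Finset.mem_image.mp (Finset.min'_mem _ hne)
      rw [← hj]; exact hc0 j
    have hmem : ε / 2 ∈ Ioo (0 : ℝ) 1 := ⟨by linarith, by linarith [min_le_right ((Finset.univ.image c).min' hne) 1]⟩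
    obtain ⟨j, hj⟩ := mem_iUnion.mp (hcov hmem)
    have hεc : ε ≤ c j := (min_le_left _ _).trans (Finset.min'_le _ _ (Finset.mem_image.mpr ⟨j, Finset.mem_univ _, rfl⟩))
    exact Set.disjoint_left.mp (hdisj j) (show ε / 2 ∈ Ioo 0 (c j) from ⟨by linarith, by linarith⟩) hj
  · have hmem : (1 / 2 : ℝ) ∈ Ioo (0 : ℝ) 1 := ⟨by norm_num, by norm_num⟩
    obtain ⟨j, -⟩ := mem_iUnion.mp (hcov hmem)
    exact hJ.elim j

/-- **Pigeonhole for a finite cover of a segment**: if `N ≥ 1` sets cover `[a, b]`, one of them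
meets `[a, b]` in a set of Lebesgue measure `≥ (b − a)/N`. [folklore] -/
theorem exists_index_volume_ge {J : Type} [Fintype J] [Nonempty J] {a b : ℝ}
    (C : J → Set ℝ) (hcov : Icc a b ⊆ ⋃ j, C j) :
    ∃ j, ENNReal.ofReal ((b - a) / Fintype.card J) ≤ volume (C j ∩ Icc a b) := by
  classical
  by_contra hlt
  push Not at hlt
  have hsum : volume (Icc a b) ≤ ∑ j, volume (C j ∩ Icc a b) := by
    calc volume (Icc a b) ≤ volume (⋃ j, C j ∩ Icc a b) := by
          apply measure_mono
          intro x hx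
          obtain ⟨j, hj⟩ := mem_iUnion.mp (hcov hx)
          exact mem_iUnion.mpr ⟨j, hj, hx⟩
      _ ≤ ∑ j, volume (C j ∩ Icc a b) := measure_iUnion_fintype_le _ _
  have hN : (0 : ℝ) < Fintype.card J := by exact_mod_cast Fintype.card_pos
  have hlt' : ∑ j, volume (C j ∩ Icc a b) < ∑ _j : J, ENNReal.ofReal ((b - a) / Fintype.card J) :=
    ENNReal.sum_lt_sum_of_nonempty Finset.univ_nonempty fun j _ => hlt j
  rw [Finset.sum_const, Finset.card_univ, nsmul_eq_mul] at hlt'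
  have heq : (Fintype.card J : ENNReal) * ENNReal.ofReal ((b - a) / Fintype.card J) = ENNReal.ofReal (b - a) := by
    rw [← ENNReal.ofReal_natCast, ← ENNReal.ofReal_mul (by positivity)]
    congr 1; field_simp
  rw [heq, ← Real.volume_Icc] at hlt'
  exact absurd (hsum.trans_lt hlt') (lt_irrefl _)

/-- **A large order-connected set contains a long closed segment**: an order-connected
`C ⊆ [a, b]` of measure `≥ ℓ > 0` contains a closed segment of length `ℓ/2`. [folklore] -/
theorem exists_Icc_subset_of_ordConnected {C : Set ℝ} (hC : C.OrdConnected) {a b ℓ : ℝ}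
    (hCab : C ⊆ Icc a b) (hℓ : 0 < ℓ) (hvol : ENNReal.ofReal ℓ ≤ volume C) :
    ∃ a' b', b' - a' = ℓ / 2 ∧ Icc a' b' ⊆ C := by
  have hne : C.Nonempty := by
    by_contra h
    rw [not_nonempty_iff_eq_empty] at h
    rw [h, measure_empty] at hvol
    exact absurd hvol (by simpa using hℓ)
  have hbdd : BddBelow C ∧ BddAbove C := ⟨⟨a, fun x hx => (hCab hx).1⟩, ⟨b, fun x hx => (hCab hx).2⟩⟩
  set lo := sInf C with hlo
  set hi := sSup C with hhi
  -- `C ⊆ [lo, hi]`, so `hi - lo ≥ ℓ`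
  have hsub : C ⊆ Icc lo hi := fun x hx => ⟨csInf_le hbdd.1 hx, le_csSup hbdd.2 hx⟩
  have hlen : ℓ ≤ hi - lo := by
    have h1 : volume C ≤ ENNReal.ofReal (hi - lo) := by
      rw [← Real.volume_Icc]; exact measure_mono hsub
    have := hvol.trans h1
    rwa [ENNReal.ofReal_le_ofReal_iff] at this
    by_contra hneg; push Not at hneg
    rw [ENNReal.ofReal_of_nonpos hneg.le] at this
    exact absurd this (by simpa using hℓ)
  -- the open interval `(lo, hi)` lies in `C`
  have hIoo : Ioo lo hi ⊆ C := by
    intro x hx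
    obtain ⟨y, hy, hyx⟩ := exists_lt_of_csInf_lt hne hx.1
    obtain ⟨z, hz, hxz⟩ := exists_lt_of_lt_csSup hne hx.2
    exact hC.out hy hz ⟨hyx.le, hxz.le⟩
  refine ⟨lo + ℓ / 4, lo + ℓ / 4 + ℓ / 2, by ring, fun x hx => hIoo ⟨?_, ?_⟩⟩
  · linarith [hx.1]
  · linarith [hx.2]

/-- **Lipschitz charts reach interior values away from the ends**: if `F` is `1`-Lipschitz on
`(0,1)` and `[a', b'] ⊆ F((0,1))` with `b' − a' > 4δ`, `0 < δ < 1/2`, then some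
`t ∈ [δ, 1 − δ]` has `F t ∈ [a', b']` (Bhardwaj–van den Dries 2022, proof of Lemma 6.1: *"the
`F_{si}`-images of the intervals `(0,δ)` and `(1−δ,1)` cannot cover a segment `[a_s, b_s]`"*).
[cite: BhardwajVanDenDries2022, Lemma 6.1 (proof)] -/
theorem exists_mem_Icc_preimage_of_lipschitz {F : ℝ → ℝ} (hF : LipschitzOnWith 1 F (Ioo 0 1))
    {a' b' δ : ℝ} (hδ : 0 < δ) (hδ2 : δ < 1 / 2) (hlen : 4 * δ < b' - a')
    (hsub : Icc a' b' ⊆ F '' Ioo 0 1) :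
    ∃ t ∈ Icc δ (1 - δ), F t ∈ Icc a' b' := by
  -- the images of `(0, δ]` and `[1 − δ, 1)` are short
  have hδI : δ ∈ Ioo (0 : ℝ) 1 := ⟨hδ, by linarith⟩
  have hδI' : 1 - δ ∈ Ioo (0 : ℝ) 1 := ⟨by linarith, by linarith⟩
  have hnear0 : ∀ t ∈ Ioo (0 : ℝ) 1, t ≤ δ → |F t - F δ| ≤ δ := by
    intro t ht htδ
    have h := hF.dist_le_mul t ht δ hδI
    rw [NNReal.coe_one, one_mul, Real.dist_eq, Real.dist_eq] at h
    have : |t - δ| ≤ δ := by rw [abs_of_nonpos (by linarith)]; linarith [ht.1]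
    exact h.trans this
  have hnear1 : ∀ t ∈ Ioo (0 : ℝ) 1, 1 - δ ≤ t → |F t - F (1 - δ)| ≤ δ := by
    intro t ht htδ
    have h := hF.dist_le_mul t ht (1 - δ) hδI'
    rw [NNReal.coe_one, one_mul, Real.dist_eq, Real.dist_eq] at h
    have : |t - (1 - δ)| ≤ δ := by rw [abs_of_nonneg (by linarith)]; linarith [ht.2]
    exact h.trans this
  -- a point of `[a', b']` outside both short images
  obtain ⟨y, hy, hy0, hy1⟩ : ∃ y ∈ Icc a' b', δ < |y - F δ| ∧ δ < |y - F (1 - δ)| := by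
    -- among the five points `a' + i (b'-a')/4`, pairwise `> δ` apart… simpler: the bad set is a union of
    -- two intervals of length `2δ` each, total `4δ < b' - a'`
    by_contra hnone
    push Not at hnone
    -- every point of `[a', b']` is within `δ` of `F δ` or of `F (1-δ)`
    have hcover : Icc a' b' ⊆ Icc (F δ - δ) (F δ + δ) ∪ Icc (F (1 - δ) - δ) (F (1 - δ) + δ) := by
      intro y hy
      rcases le_or_gt (|y - F δ|) δ with h | h
      · left; rw [abs_le] at h; constructor <;> linarith [h.1, h.2]
      · right; have h' := hnone y hy h; rw [abs_le] at h'; constructor <;> linarith [h'.1, h'.2]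
    have hvol : volume (Icc a' b') ≤ volume (Icc (F δ - δ) (F δ + δ)) + volume (Icc (F (1 - δ) - δ) (F (1 - δ) + δ)) :=
      (measure_mono hcover).trans (measure_union_le _ _)
    rw [Real.volume_Icc, Real.volume_Icc, Real.volume_Icc, ← ENNReal.ofReal_add (by linarith) (by linarith),
      ENNReal.ofReal_le_ofReal_iff (by linarith)] at hvol
    linarith
  obtain ⟨t, ht, rfl⟩ := hsub hy
  refine ⟨t, ⟨?_, ?_⟩, hy⟩
  · by_contra h; push Not at h
    exact absurd (hnear0 t ht h.le) (not_le.mpr hy0)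
  · by_contra h; push Not at h
    exact absurd (hnear1 t ht h.le) (not_le.mpr hy1)

end CoverLemmas

/-! ### Bhardwaj–van den Dries 2022, Lemma 6.1 (A): the limit charts cover a cofinite set -/

section LemmaA

open Classical

variable {L : Language} [L.Structure ℝ]

/-- **Bhardwaj–van den Dries 2022, Lemma 6.1 (A)** (*"`⋃_{ψ ∈ Φ₀} image(ψ)` is a cofinite
subset of `(0,1)`"*), over `ℝ`: for finitely many definable one-parameter families of
`1`-Lipschitz charts `F_j(s, ·) : (0,1) → (0,1)` whose images cover `(0,1)` for every
`s ∈ (0,1)`, with pointwise limits `G_j = lim_{s→0⁺} F_j(s,·)` continuous on `(0,1)` and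
definable, the images of the `G_j` cover `(0,1)` up to a finite set.  Proof as printed:
otherwise an interval `[a, b]` is missed; by pigeonhole and o-minimality one index `j` has,
for all small `s`, a segment of `F_j(s,(0,1)) ∩ [a,b]` of definite length, hence (Lipschitz) a
point `t_s ∈ [δ, 1−δ]` with `F_j(s, t_s) ∈ [a, b]`, chosen definably; the limit point `t₀`
has `G_j(t₀) ∈ [a, b]` by uniform convergence on `[δ, 1−δ]`. [cite: BhardwajVanDenDries2022, Lemma 6.1] -/
theorem finite_compl_iUnion_image_limitCharts (hO : L.IsOMinimal ℝ)
    (hadd : (univ : Set ℝ).Definable L {v : Fin 3 → ℝ | v 0 + v 1 = v 2})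
    (hmul : (univ : Set ℝ).Definable L {v : Fin 3 → ℝ | v 0 * v 1 = v 2})
    {J : Type} [Fintype J] (F : J → ℝ → ℝ → ℝ) (G : J → ℝ → ℝ)
    (hFdef : ∀ j, IsDefinableFamily₁ L (fun w : Fin 1 → ℝ => F j (w 0)))
    (hGdef : ∀ j, (univ : Set ℝ).Definable L {v : Fin 2 → ℝ | v 1 = G j (v 0)})
    (hcov : ∀ s ∈ Ioo (0 : ℝ) 1, Ioo (0 : ℝ) 1 ⊆ ⋃ j, F j s '' Ioo 0 1)
    (hlip : ∀ j, ∀ s ∈ Ioo (0 : ℝ) 1, LipschitzOnWith 1 (F j s) (Ioo 0 1))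
    (hlim : ∀ j, ∀ t ∈ Ioo (0 : ℝ) 1, Tendsto (fun s => F j s t) (𝓝[>] 0) (𝓝 (G j t)))
    (hGc : ∀ j, ContinuousOn (G j) (Ioo 0 1)) :
    (Ioo (0 : ℝ) 1 \ ⋃ j, G j '' Ioo 0 1).Finite := by
  have hlt := definable_lt_of_field hadd hmul
  by_contra hinf
  rw [← Set.not_infinite, not_not] at hinf
  ----------------------------------------------------------------- an interval `[a, b]` missed
  have hRdef : (univ : Set ℝ).Definable₁ L (Ioo (0 : ℝ) 1 \ ⋃ j, G j '' Ioo 0 1) := by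
    unfold Set.Definable₁
    have hI : (univ : Set ℝ).Definable L {u : Fin 1 → ℝ | 0 < u 0 ∧ u 0 < 1} :=
      definable_setOf_and (definable_setOf_lt hlt (definableFun_const' _ _) (definableFun_proj _))
        (definable_setOf_lt hlt (definableFun_proj _) (definableFun_const' _ _))
    have himg : ∀ j, (univ : Set ℝ).Definable L {u : Fin 1 → ℝ | ∃ t, (0 < t ∧ t < 1) ∧ u 0 = G j t} := by
      intro j
      apply definable_setOf_exists
      refine definable_setOf_and (definable_setOf_and
        (definable_setOf_lt hlt (definableFun_const' _ _) (definableFun_proj _))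
        (definable_setOf_lt hlt (definableFun_proj _) (definableFun_const' _ _))) ?_
      have h := (hGdef j).preimage_comp (![Sum.inr (), Sum.inl 0] : Fin 2 → Fin 1 ⊕ Unit)
      convert h using 1
      ext w; simp
    have h := hI.sdiff (definable_iUnion_of_finite himg)
    convert h using 1
    ext u
    simp only [mem_setOf_eq, Set.mem_sdiff, mem_Ioo, mem_iUnion, mem_image]
    constructor
    · rintro ⟨h1, h2⟩
      exact ⟨h1, fun ⟨j, t, ht, htu⟩ => h2 ⟨j, t, ht, htu.symm⟩⟩
    · rintro ⟨h1, h2⟩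
      exact ⟨h1, fun ⟨j, t, ht, htu⟩ => h2 ⟨j, t, ht, htu.symm⟩⟩
  obtain ⟨a₀, b₀, hab₀, hR⟩ := (hO _ hRdef).exists_Ioo_subset_of_infinite hinf
  set a : ℝ := (2 * a₀ + b₀) / 3 with ha
  set b : ℝ := (a₀ + 2 * b₀) / 3 with hb
  have hab : a < b := by rw [ha, hb]; linarith
  have hIccR : Icc a b ⊆ Ioo (0 : ℝ) 1 \ ⋃ j, G j '' Ioo 0 1 := by
    intro y hy
    apply hR
    have h1 := hy.1; have h2 := hy.2
    rw [ha] at h1; rw [hb] at h2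
    exact ⟨by linarith, by linarith⟩
  have hIccI : Icc a b ⊆ Ioo (0 : ℝ) 1 := fun y hy => (hIccR hy).1
  ----------------------------------------------------------------- the index set is non-empty
  have hJ : Nonempty J := by
    have h12 : (1 / 2 : ℝ) ∈ Ioo (0 : ℝ) 1 := ⟨by norm_num, by norm_num⟩
    obtain ⟨j, -⟩ := mem_iUnion.mp (hcov (1 / 2) h12 h12)
    exact ⟨j⟩
  set N : ℕ := Fintype.card J with hN
  have hN1 : 1 ≤ N := Fintype.card_pos
  set lam : ℝ := (b - a) / N / 2 with hlam
  have hlam0 : 0 < lam := by rw [hlam]; positivity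
  have hlam1 : lam ≤ 1 / 2 := by
    rw [hlam]
    have hba : b - a ≤ 1 := by linarith [(hIccI (left_mem_Icc.mpr hab.le)).1, (hIccI (right_mem_Icc.mpr hab.le)).2]
    have hNR : (1 : ℝ) ≤ N := by exact_mod_cast hN1
    calc (b - a) / N / 2 ≤ 1 / 1 / 2 := by gcongr
      _ = 1 / 2 := by norm_num
  set δ : ℝ := lam / 5 with hδ
  have hδ0 : 0 < δ := by rw [hδ]; positivity
  have hδ2 : δ < 1 / 2 := by rw [hδ]; linarith
  have h4δ : 4 * δ < lam := by rw [hδ]; linarith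
  ----------------------------------------------------------------- for each `s`, a good index
  set P : J → ℝ → Prop := fun j s => ∃ a' b' : ℝ, (b' - a' = lam ∧ a ≤ a' ∧ b' ≤ b) ∧
      ∀ y, a' ≤ y ∧ y ≤ b' → ∃ t, (0 < t ∧ t < 1) ∧ F j s t = y with hP
  have hPall : ∀ s ∈ Ioo (0 : ℝ) 1, ∃ j, P j s := by
    intro s hs
    haveI := hJ
    obtain ⟨j, hj⟩ := exists_index_volume_ge (fun j => F j s '' Ioo 0 1) (hIccI.trans (hcov s hs))
    have hoc : (F j s '' Ioo 0 1 ∩ Icc a b).OrdConnected :=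
      ((isPreconnected_Ioo.image _ (hlip j s hs).continuousOn).ordConnected).inter ordConnected_Icc
    have hℓ : 0 < (b - a) / N := by positivity
    obtain ⟨a', b', hlen, hsub⟩ := exists_Icc_subset_of_ordConnected hoc inter_subset_right hℓ hj
    refine ⟨j, a', b', ⟨by rw [hlen, hlam], ?_, ?_⟩, fun y hy => ?_⟩
    · have := (hsub (left_mem_Icc.mpr (by linarith))).2; exact this.1
    · have := (hsub (right_mem_Icc.mpr (by linarith))).2; exact this.2
    · obtain ⟨t, ht, hty⟩ := (hsub ⟨hy.1, hy.2⟩).1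
      exact ⟨t, ⟨ht.1, ht.2⟩, hty⟩
  -- the sets `S j = {s | P j s}` are definable
  have hSdef : ∀ j, (univ : Set ℝ).Definable₁ L {s | P j s} := by
    intro j
    unfold Set.Definable₁
    simp only [hP]
    -- variables: `s` then `a'`, `b'`, `y`, `t`
    apply definable_setOf_exists
    apply definable_setOf_exists
    refine definable_setOf_and ?_ ?_
    · refine definable_setOf_and ?_ (definable_setOf_and ?_ ?_)
      · exact definable_setOf_eq' (definableFun_sub hadd (definableFun_proj _) (definableFun_proj _)) (definableFun_const' _ _)
      · exact definable_setOf_le hlt (definableFun_const' _ _) (definableFun_proj _)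
      · exact definable_setOf_le hlt (definableFun_proj _) (definableFun_const' _ _)
    · apply definable_setOf_forall
      refine definable_setOf_imp (definable_setOf_and (definable_setOf_le hlt (definableFun_proj _) (definableFun_proj _))
        (definable_setOf_le hlt (definableFun_proj _) (definableFun_proj _))) ?_
      apply definable_setOf_exists
      refine definable_setOf_and (definable_setOf_and
        (definable_setOf_lt hlt (definableFun_const' _ _) (definableFun_proj _))
        (definable_setOf_lt hlt (definableFun_proj _) (definableFun_const' _ _))) ?_
      exact definable_setOf_eq' ((hFdef j).definableFun (fun _ => definableFun_proj _) (definableFun_proj _))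
        (definableFun_proj _)
  obtain ⟨j₀, ε, hε, hεS⟩ := exists_index_Ioo_subset hO (fun j => {s | P j s}) hSdef
    (fun s hs => mem_iUnion.mpr (hPall s hs))
  ----------------------------------------------------------------- the definable selection `t_s`
  set T : ℝ → Set ℝ := fun s => {t | (δ ≤ t ∧ t ≤ 1 - δ) ∧ (a ≤ F j₀ s t ∧ F j₀ s t ≤ b)} with hT
  set tsel : ℝ → ℝ := fun s => sInf (T s) with htsel
  have htseldef : (univ : Set ℝ).DefinableFun L (fun w : Fin 1 → ℝ => tsel (w 0)) := by
    simp only [htsel, hT]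
    refine definableFun_sInf hadd hmul (W := fun (w : Fin 1 → ℝ) t => (δ ≤ t ∧ t ≤ 1 - δ) ∧ (a ≤ F j₀ (w 0) t ∧ F j₀ (w 0) t ≤ b)) ?_
    refine definable_setOf_and (definable_setOf_and
      (definable_setOf_le hlt (definableFun_const' _ _) (definableFun_proj _))
      (definable_setOf_le hlt (definableFun_proj _) (definableFun_const' _ _))) (definable_setOf_and ?_ ?_)
    · exact definable_setOf_le hlt (definableFun_const' _ _) ((hFdef j₀).definableFun (fun _ => definableFun_proj _) (definableFun_proj _))
    · exact definable_setOf_le hlt ((hFdef j₀).definableFun (fun _ => definableFun_proj _) (definableFun_proj _)) (definableFun_const' _ _)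
  set ε' : ℝ := min ε 1 with hε'
  have hε'0 : 0 < ε' := lt_min hε one_pos
  have hTmem : ∀ s ∈ Ioo (0 : ℝ) ε', tsel s ∈ T s := by
    intro s hs
    have hsI : s ∈ Ioo (0 : ℝ) 1 := ⟨hs.1, hs.2.trans_le (min_le_right _ _)⟩
    obtain ⟨a', b', ⟨hlen, haa', hb'b⟩, hsub⟩ := hεS ⟨hs.1, hs.2.trans_le (min_le_left _ _)⟩
    have hsub' : Icc a' b' ⊆ F j₀ s '' Ioo 0 1 := fun y hy => by
      obtain ⟨t, ht, hty⟩ := hsub y ⟨hy.1, hy.2⟩; exact ⟨t, ht, hty⟩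
    obtain ⟨t, ht, hFt⟩ := exists_mem_Icc_preimage_of_lipschitz (hlip j₀ s hsI) hδ0 hδ2 (by rw [hlen]; exact h4δ) hsub'
    have hne : (T s).Nonempty := ⟨t, ⟨ht.1, ht.2⟩, haa'.trans hFt.1, hFt.2.trans hb'b⟩
    have hclosed : IsClosed (T s) := by
      have hcont : ContinuousOn (F j₀ s) (Icc δ (1 - δ)) :=
        (hlip j₀ s hsI).continuousOn.mono fun t ht => ⟨hδ0.trans_le ht.1, by linarith [ht.2]⟩
      have := hcont.preimage_isClosed_of_isClosed isClosed_Icc (isClosed_Icc (a := a) (b := b))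
      convert this using 1
      ext t; simp [hT, mem_Icc]
    have hbdd : BddBelow (T s) := ⟨δ, fun t ht => ht.1.1⟩
    exact hclosed.csInf_mem hne hbdd
  ----------------------------------------------------------------- the limit point `t₀`
  obtain ⟨t₀, ht₀⟩ : ∃ t₀, Tendsto tsel (𝓝[>] 0) (𝓝 t₀) := by
    refine exists_tendsto_nhdsGT_of_bounded hO hlt ?_ hε'0 (c := 1) fun s hs => ?_
    · have h := definable_graph_of_family (Φ := fun (_ : Fin 0 → ℝ) u => tsel u)
        (fun γ _ q t _ ht => htseldef.comp (fun _ => ht)) Fin.elim0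
      simpa using h
    · rw [zero_add] at hs
      have h := (hTmem s hs).1
      rw [abs_le]; constructor <;> linarith [h.1, h.2]
  have ht₀mem : t₀ ∈ Icc δ (1 - δ) :=
    isClosed_Icc.mem_of_tendsto ht₀ (by
      filter_upwards [Ioo_mem_nhdsGT hε'0] with s hs using (hTmem s hs).1)
  have ht₀I : t₀ ∈ Ioo (0 : ℝ) 1 := ⟨hδ0.trans_le ht₀mem.1, by linarith [ht₀mem.2]⟩
  ----------------------------------------------------------------- uniform convergence on `[δ, 1 − δ]`
  -- extend the family by the limit outside `(0,1)` to have Lipschitz maps for all indices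
  have hGlip : LipschitzOnWith 1 (G j₀) (Ioo 0 1) := by
    refine LipschitzOnWith.of_dist_le_mul fun x hx y hy => ?_
    have h : Tendsto (fun s => dist (F j₀ s x) (F j₀ s y)) (𝓝[>] 0) (𝓝 (dist (G j₀ x) (G j₀ y))) :=
      ((hlim j₀ x hx).dist (hlim j₀ y hy))
    refine le_of_tendsto h ?_
    filter_upwards [Ioo_mem_nhdsGT one_pos] with s hs
    exact (hlip j₀ s hs).dist_le_mul x hx y hy
  set Ft : ℝ → ℝ → ℝ := fun s => if s ∈ Ioo (0 : ℝ) 1 then F j₀ s else G j₀ with hFt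
  have hFtlip : ∀ s, LipschitzOnWith 1 (Ft s) (Ioo 0 1) := by
    intro s; simp only [hFt]; split_ifs with h
    · exact hlip j₀ s h
    · exact hGlip
  have hFtlim : ∀ t ∈ Ioo (0 : ℝ) 1, Tendsto (fun s => Ft s t) (𝓝[>] 0) (𝓝 (G j₀ t)) := by
    intro t ht
    refine (hlim j₀ t ht).congr' ?_
    filter_upwards [Ioo_mem_nhdsGT one_pos] with s hs
    simp only [hFt, hs, if_true]
  have hloc := tendstoLocallyUniformlyOn_of_lipschitzOnWith isOpen_Ioo hFtlip hFtlim
  have hunif : TendstoUniformlyOn Ft (G j₀) (𝓝[>] 0) (Icc δ (1 - δ)) :=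
    (tendstoLocallyUniformlyOn_iff_forall_isCompact isOpen_Ioo).mp hloc _
      (fun t ht => ⟨hδ0.trans_le ht.1, by linarith [ht.2]⟩) isCompact_Icc
  ----------------------------------------------------------------- `G j₀ t₀ ∈ [a, b]`: contradiction
  have hconv : Tendsto (fun s => F j₀ s (tsel s)) (𝓝[>] 0) (𝓝 (G j₀ t₀)) := by
    rw [Metric.tendsto_nhds]
    intro η hη
    have h1 : ∀ᶠ s in 𝓝[>] (0 : ℝ), ∀ t ∈ Icc δ (1 - δ), dist (G j₀ t) (Ft s t) < η / 2 := by
      rw [Metric.tendstoUniformlyOn_iff] at hunif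
      exact hunif (η / 2) (half_pos hη)
    have h2 : ∀ᶠ s in 𝓝[>] (0 : ℝ), dist (G j₀ (tsel s)) (G j₀ t₀) < η / 2 := by
      have hc : ContinuousAt (G j₀) t₀ := (hGc j₀).continuousAt (isOpen_Ioo.mem_nhds ht₀I)
      have := (hc.tendsto.comp ht₀)
      rw [Metric.tendsto_nhds] at this
      exact this (η / 2) (half_pos hη)
    filter_upwards [h1, h2, Ioo_mem_nhdsGT hε'0] with s hs1 hs2 hs
    have hsI : s ∈ Ioo (0 : ℝ) 1 := ⟨hs.1, hs.2.trans_le (min_le_right _ _)⟩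
    have hts := (hTmem s hs).1
    have h1' := hs1 (tsel s) ⟨hts.1, hts.2⟩
    simp only [hFt, hsI, if_true] at h1'
    calc dist (F j₀ s (tsel s)) (G j₀ t₀) ≤ dist (F j₀ s (tsel s)) (G j₀ (tsel s)) + dist (G j₀ (tsel s)) (G j₀ t₀) :=
          dist_triangle _ _ _
      _ < η / 2 + η / 2 := by rw [dist_comm] at h1'; exact add_lt_add h1' hs2
      _ = η := by ring
  have hmemab : G j₀ t₀ ∈ Icc a b :=
    isClosed_Icc.mem_of_tendsto hconv (by
      filter_upwards [Ioo_mem_nhdsGT hε'0] with s hs using ⟨(hTmem s hs).2.1, (hTmem s hs).2.2⟩)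
  have hnot := (hIccR hmemab).2
  exact hnot (mem_iUnion.mpr ⟨j₀, t₀, ht₀I, rfl⟩)

end LemmaA


end Literature.ModelTheory.ExponentialFields

end
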